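import Summits.NavierStokesRegularity.TurbBounds.ShearSpecProj
import Summits.NavierStokesRegularity.TurbBounds.ShearTailSeq
import HarnessLib

/-!
# Dictionary between the SPEC tables and the Legendre ladder sequences (`a = D1 c`, `b = D0c c`; `H1form`, `G0form` as table forms)

Cell `turb-bounds` (pub-turb), shear lane, pub-turb-shear gen 6 (2026-08-22); v2 lane. The bridge files express `ωᵀ Q_m ω` through the row functionals
`lin (d1Rows N P) L2 n c` and `lin (d0cRows N P) L2 n c` of the `W″`-coefficient vector `c`; the tail lemma (`ShearTailSeq`) and the analytic side
(`LegendreCoeffs.isLadder_legCoeff`) speak of sequences `a`, `b` with `IsLadder c a`, `IsLadder a b` (+ the `n = 0` wall relations). Here: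
* `lin_d1Rows` / `lin_d0cRows` — the table rows written out (`x_{n−1}/(2n−1) − x_{n+1}/(2n+3)`, resp. `x_0 − x_1/3` at `n = 0`);
* `lin_d1Rows_eq_ladder` : `IsLadder c a ∧ a 0 = c 0 − c 1/3 ⇒ lin d1Rows n c = a n` (`n < N+P+3`); `lin_d0cRows_eq_ladder` likewise for `b` (`n < N+P+2`);
* `H1form_eq_qform`, `G0form_eq_qform` — `ShearTailSeq.H1form N P c = cᵀ·diag(h1Diag)·c`, `G0form N a = cᵀ G0 c` (so `H0form = cᵀH0c`, and `rem_lower_bound_pair` of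
  ShearTailSeq applies verbatim to the forms produced by `ShearSpecQForms` / `ShearSpecProj`).
PURE ALGEBRA. HONEST FRAMING: rigorous bounds for the stated PDE and boundary conditions; no claim about physical turbulence beyond the bound.
-/

set_option linter.style.longLine false

namespace Summit.NavierStokesRegularity.TurbBounds.ShearSpecPieces

open Finset Summit.NavierStokesRegularity.TurbBounds.LadderTail Summit.NavierStokesRegularity.TurbBounds.ShearTailSeq

/-- A two-point evaluation of a `range` sum. -/
theorem sum_two_points {L : ℕ} (f : ℕ → ℝ) (p q : ℕ) (hp : p < L) (hq : q < L) (hpq : p ≠ q) (h0 : ∀ j < L, j ≠ p → j ≠ q → f j = 0) :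
    ∑ j ∈ range L, f j = f p + f q := by
  rw [Finset.sum_eq_add_of_mem p q (by simpa using hp) (by simpa using hq) hpq]
  intro j hj hne; exact h0 j (by simpa using hj) hne.1 hne.2

/-- **`D1` rows written out**: `(D1 x)_n = x_0 − x_1/3` (`n = 0`), `x_{n−1}/(2n−1) − x_{n+1}/(2n+3)` (`1 ≤ n < N+P+3`). -/
theorem lin_d1Rows (N P n : ℕ) (hn : n < N + P + 3) (x : ℕ → ℝ) :
    lin (d1Rows N P) (N + P + 4) n x
      = if n = 0 then x 0 - x 1 / 3 else x (n - 1) / (2 * (n : ℝ) - 1) - x (n + 1) / (2 * (n : ℝ) + 3) := by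
  unfold lin
  have hent : ∀ j < N + P + 4, (get2 (d1Rows N P) n j : ℝ) = ((intEntry n j : ℚ) : ℝ) := by
    intro j hj; rw [get2_d1Rows, if_pos ⟨hn, hj⟩]
  by_cases h0 : n = 0
  · subst h0
    rw [if_pos rfl, sum_two_points _ 0 1 (by omega) (by omega) (by omega)]
    · rw [hent 0 (by omega), hent 1 (by omega)]; unfold intEntry; push_cast; simp; ring
    · intro j hj h1 h2; rw [hent j hj]; unfold intEntry; simp [h1, h2]
  · rw [if_neg h0, sum_two_points _ (n - 1) (n + 1) (by omega) (by omega) (by omega)]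
    · rw [hent (n - 1) (by omega), hent (n + 1) (by omega)]; unfold intEntry
      have e1 : n - 1 + 1 = n := by omega
      have e2 : ¬ n - 1 = n + 1 := by omega
      have e3 : ¬ (n + 1) + 1 = n := by omega
      simp only [h0, e1, e2, e3, if_true, if_false]
      push_cast; ring
    · intro j hj h1 h2; rw [hent j hj]; unfold intEntry
      have e2 : ¬ j + 1 = n := by omega
      have e3 : ¬ j = n + 1 := h2
      simp [h0, e2, e3]

/-- **`lin d1Rows n c = a_n`** when `a` is the ladder of `c` with the wall relation `a_0 = c_0 − c_1/3` (rbsdp SPEC 1.2; `W′ = ∫W″`, `W′(−1) = 0`). -/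
theorem lin_d1Rows_eq_ladder {N P : ℕ} {c a : ℕ → ℝ} (hA : IsLadder c a) (h0 : a 0 = c 0 - c 1 / 3) (n : ℕ) (hn : n < N + P + 3) :
    lin (d1Rows N P) (N + P + 4) n c = a n := by
  rw [lin_d1Rows N P n hn]
  rcases n with _ | m
  · simp [h0]
  · rw [if_neg (by omega), hA m, show m + 1 - 1 = m from rfl, show m + 1 + 1 = m + 2 from rfl]
    push_cast
    have h1 : (2 * (m : ℝ) + 1) ≠ 0 := by positivity
    have h2 : (2 * (m : ℝ) + 5) ≠ 0 := by positivity
    have h3 : (2 * ((m : ℝ) + 1) - 1) = 2 * (m : ℝ) + 1 := by ring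
    have h4 : (2 * ((m : ℝ) + 1) + 3) = 2 * (m : ℝ) + 5 := by ring
    rw [h3, h4]

/-- **`D0c` rows through `D1`**: `(D0c x)_n = Σ_{i<N+P+3} intEntry n i · (D1 x)_i`. -/
theorem lin_d0cRows_sum (N P n : ℕ) (hn : n < N + P + 2) (x : ℕ → ℝ) :
    lin (d0cRows N P) (N + P + 4) n x = ∑ i ∈ range (N + P + 3), ((intEntry n i : ℚ) : ℝ) * lin (d1Rows N P) (N + P + 4) i x := by
  unfold lin
  have hent : ∀ j, (get2 (d0cRows N P) n j : ℝ) = ∑ i ∈ range (N + P + 3), ((intEntry n i : ℚ) : ℝ) * (get2 (d1Rows N P) i j : ℝ) := by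
    intro j; rw [get2_d0cRows, if_pos hn, getD_d0cRow']; push_cast; rfl
  simp_rw [hent, Finset.sum_mul]
  rw [Finset.sum_comm]
  refine Finset.sum_congr rfl fun i _ => ?_
  rw [Finset.mul_sum]
  exact Finset.sum_congr rfl fun j _ => by ring

/-- **`D0c` rows written out** in terms of `D1`: `(D0c x)_0 = (D1x)_0 − (D1x)_1/3`, `(D0c x)_n = (D1x)_{n−1}/(2n−1) − (D1x)_{n+1}/(2n+3)`. -/
theorem lin_d0cRows (N P n : ℕ) (hn : n < N + P + 2) (x : ℕ → ℝ) :
    lin (d0cRows N P) (N + P + 4) n x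
      = if n = 0 then lin (d1Rows N P) (N + P + 4) 0 x - lin (d1Rows N P) (N + P + 4) 1 x / 3
        else lin (d1Rows N P) (N + P + 4) (n - 1) x / (2 * (n : ℝ) - 1) - lin (d1Rows N P) (N + P + 4) (n + 1) x / (2 * (n : ℝ) + 3) := by
  rw [lin_d0cRows_sum N P n hn]
  by_cases h0 : n = 0
  · subst h0
    rw [if_pos rfl, sum_two_points _ 0 1 (by omega) (by omega) (by omega)]
    · unfold intEntry; push_cast; simp; ring
    · intro j _ h1 h2; unfold intEntry; simp [h1, h2]
  · rw [if_neg h0, sum_two_points _ (n - 1) (n + 1) (by omega) (by omega) (by omega)]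
    · unfold intEntry
      have e1 : n - 1 + 1 = n := by omega
      have e2 : ¬ n - 1 = n + 1 := by omega
      have e3 : ¬ (n + 1) + 1 = n := by omega
      simp only [h0, e1, e2, e3, if_true, if_false]
      push_cast; ring
    · intro j _ h1 h2; unfold intEntry
      have e2 : ¬ j + 1 = n := by omega
      simp [h0, e2, h2]

/-- **`lin d0cRows n c = b_n`** for the double ladder `c → a → b` with both wall relations (`W = ∫∫W″`, `W(−1) = W′(−1) = 0`). -/
theorem lin_d0cRows_eq_ladder {N P : ℕ} {c a b : ℕ → ℝ} (hA : IsLadder c a) (h0a : a 0 = c 0 - c 1 / 3)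
    (hB : IsLadder a b) (h0b : b 0 = a 0 - a 1 / 3) (n : ℕ) (hn : n < N + P + 2) :
    lin (d0cRows N P) (N + P + 4) n c = b n := by
  rw [lin_d0cRows N P n hn]
  rcases n with _ | m
  · rw [if_pos rfl, lin_d1Rows_eq_ladder hA h0a 0 (by omega), lin_d1Rows_eq_ladder hA h0a 1 (by omega), h0b]
  · rw [if_neg (by omega), show m + 1 - 1 = m from rfl, show m + 1 + 1 = m + 2 from rfl,
      lin_d1Rows_eq_ladder hA h0a m (by omega), lin_d1Rows_eq_ladder hA h0a (m + 2) (by omega), hB m]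
    push_cast
    have h3 : (2 * ((m : ℝ) + 1) - 1) = 2 * (m : ℝ) + 1 := by ring
    have h4 : (2 * ((m : ℝ) + 1) + 3) = 2 * (m : ℝ) + 5 := by ring
    rw [h3, h4]

/-! ### `H1form`, `G0form` of `ShearTailSeq` as table forms -/

/-- The `h1Diag` entry as `LadderTail.phi/chi` indicators (cast to `ℝ`). -/
theorem h1Diag_cast (N P j : ℕ) (hj : j < N + P + 4) :
    ((h1Diag N P).getD j 0 : ℝ) = (if N + 1 ≤ j ∧ j ≤ N + P + 3 then phi j else 0) + (if N + 3 ≤ j ∧ j ≤ N + P + 3 then chi j else 0) := by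
  rw [getD_h1Diag, if_pos hj]
  unfold phi chi
  push_cast
  split_ifs <;> simp

/-- A shifted window of a `range` sum with an indicator: `Σ_{j<a+m} [a ≤ j]·f j = Σ_{k<m} f (a+k)`. -/
theorem sum_indicator_window (f : ℕ → ℝ) (a m : ℕ) :
    ∑ j ∈ range (a + m), (if a ≤ j then f j else 0) = ∑ k ∈ range m, f (a + k) := by
  rw [Finset.sum_range_add]
  have h1 : ∑ j ∈ range a, (if a ≤ j then f j else 0) = 0 := Finset.sum_eq_zero fun j hj => by
    rw [if_neg (by simpa using hj)]
  rw [h1, zero_add]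
  exact Finset.sum_congr rfl fun k _ => by rw [if_pos (by omega)]

/-- **`H1form N P c = cᵀ·diag(h1Diag N P)·c`** (ShearTailSeq's tracked `W′`-tail form IS the table's form). -/
theorem H1form_eq_qform (N P : ℕ) (c : ℕ → ℝ) : H1form N P c = qform (diagMat (h1Diag N P)) (N + P + 4) c := by
  rw [qform_diagMat]
  unfold H1form
  have hsplit : ∑ i ∈ range (N + P + 4), ((h1Diag N P).getD i 0 : ℝ) * c i ^ 2
      = ∑ i ∈ range (N + P + 4), (if N + 1 ≤ i then phi i * c i ^ 2 else 0) + ∑ i ∈ range (N + P + 4), (if N + 3 ≤ i then chi i * c i ^ 2 else 0) := by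
    rw [← Finset.sum_add_distrib]
    refine Finset.sum_congr rfl fun i hi => ?_
    have hi' : i < N + P + 4 := by simpa using hi
    rw [h1Diag_cast N P i hi']
    have e1 : (N + 1 ≤ i ∧ i ≤ N + P + 3) ↔ N + 1 ≤ i := ⟨fun h => h.1, fun h => ⟨h, by omega⟩⟩
    have e2 : (N + 3 ≤ i ∧ i ≤ N + P + 3) ↔ N + 3 ≤ i := ⟨fun h => h.1, fun h => ⟨h, by omega⟩⟩
    rw [if_congr e1 rfl rfl, if_congr e2 rfl rfl]
    split_ifs <;> ring
  rw [hsplit, show N + P + 4 = (N + 1) + (P + 3) by ring, sum_indicator_window,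
    show (N + 1) + (P + 3) = (N + 3) + (P + 1) by ring, sum_indicator_window]

/-- **`G0form N a = cᵀ G0 c`** when `a = D1 c` (ladder + wall relation). -/
theorem G0form_eq_qform {N P : ℕ} {c a : ℕ → ℝ} (hA : IsLadder c a) (h0 : a 0 = c 0 - c 1 / 3) :
    G0form N a = qform (g0Tab N P) (N + P + 4) c := by
  rw [qform_g0Tab, lin_d1Rows_eq_ladder hA h0 N (by omega), lin_d1Rows_eq_ladder hA h0 (N + 1) (by omega)]
  unfold G0form phi
  push_cast
  ring

/-- **`H0form N P c a = cᵀ H0 c`** (`a = D1 c`). -/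
theorem H0form_eq_qform {N P : ℕ} {c a : ℕ → ℝ} (hA : IsLadder c a) (h0 : a 0 = c 0 - c 1 / 3) :
    H0form N P c a = qform (h0Tab N P) (N + P + 4) c := by
  unfold H0form
  rw [qform_h0Tab, G0form_eq_qform (P := P) hA h0, H1form_eq_qform]
  unfold ShearTailSeq.mu
  rw [show (ShearSpecPieces.mu N : ℝ) = lam N by unfold ShearSpecPieces.mu lam; push_cast; ring]

end Summit.NavierStokesRegularity.TurbBounds.ShearSpecPieces
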